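import Literature.Probability.Percolation.KhSThreeDisorderObservable
import HarnessLib

/-!
# The census size law: every face of an odd-marked domain carries exactly `2^{#G − 2}` cores («CORE-COUNT»)

Topic `Literature/Probability/Percolation`; generic-`k` layer of the three-disorder lineage (Khristoforov–Smirnov 2021), a rider on
`KhSThreeDisorderObservable.lean` (cores `IsCoreb`, `E⁻(v)`, `AllSides`) and `MarkedLoopSpace.lean` (Khristoforov–Smirnov's count «exactly `2^{#Faces(Ω)}` loop
configurations with given disorders»: `card_filter_parity_eq`). THE SIZE OF EVERY KERNEL CENSUS (`MarkedLoopCoreCensus.lean`, the 64 = 2⁶ cores per face of the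
eight-site rhombus): ★★ `card_cores_eq` — at a face `v` with three `H_G`-sides of a `k`-marked domain with `k` ODD, the cores at `v` with all three neighbours odd
number exactly `2 ^ (#G − 2)`; hence ★ `exists_eq_of_card_table`: a census table of that many distinct cores is COMPLETE (completeness by counting, an
alternative to the peeling schedule of `MarkedLoopCoreCensus.lean`).

Proof: the edge sets `ξ ⊆ H_G` with odd faces = corners XOR the three neighbours of `v` number `2^{#G}` (the tree's count; the target is even because `k` is odd);
by the parity at `v` itself such a `ξ` contains an EVEN number of the three sides of `v` — none (the cores) or the two sides at one vertex `x_m` of `v`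
(`m : Fin 3`); toggling the HEXAGON CYCLE around `x_m` (if `x_m ∈ G`) or the two hexagon cycles around the other two vertices (if not: they lie in `G`) is a
parity-preserving involution of that family exchanging «no side» with «the two sides at `x_m`» (`§ Hexagon`: hexagon cycles are even at every face and meet
the sides of `v` exactly in the two sides at their centre), so the four classes are equinumerous.

## References
* M. Khristoforov, S. Smirnov, *Percolation and O(1) loop model*, arXiv:2111.15612 (2021), §1.2 (arXiv v1 pp. 2–3: `W_Ω(U)`; «exactly `2^{#Faces(Ω)}` loop
  configurations»; p. 4: «ξ₁ ⊕ ξ₂ is a union of loops»), §2 Lemma 4, proof and Fig. 3 (p. 4: the triples at a vertex).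
* B. Bollobás, O. Riordan, *Percolation*, Cambridge University Press (2006), Ch. 7 §7.2.2 (pp. 191–195), Lemma 12 (pp. 206–207).

## Mathlib / tree
Tree: `KhSThreeDisorderObservable.lean` (`IsCoreb`, `Eminus`, `AllSides`, `hbK_yc_ne_v`), `MarkedLoopSpace.lean` (`hBonds`, `mem_hBonds`, `card_filter_parity_eq`, `corners`,
`yc_injective`, `yc_mem_touching`, `mem_touching_of_side_mem`), `FivePointNormalisation.lean` (`xorDeg_holds`, `l1_xiDeg_eq`, `side_oppFace_oppIdx`), `FiveMarkedLoopSpace.lean`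
(`side`, `side_injective`), `TriDiscShelling.lean` (`triDir`, `triGraph_adj_iff_triDir`, `faceVertex_injective`), `TriDiscInterface.lean` (`adj_faceVertex_succ`). Mathlib:
`Finset.card_bij`, `Finset.card_symmDiff`-free parity via `xorDeg_holds`, `decide`.
-/

open Finset

namespace Literature.Probability.Percolation.MarkedLoops

open Literature.Probability.Percolation Literature.Probability.LatticeModels
open Literature.Probability.Percolation.FivePoint (xiDeg side side_injective oppFace_injective')
open Literature.Probability.Percolation.FivePoint.N5 (xorDeg_holds l1_xiDeg_eq side_oppFace_oppIdx)
open TriMarkedDomain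

variable {nm : ℕ} {D : TriMarkedDomain nm}

/-! ### Hexagon cycles -/
section Hexagon

/-- **the hexagon cycle around a site** `x`: its six bonds (the boundary of the hexagonal face `x` of `H`).
[cite: KhristoforovSmirnov2021, §1.2 (arXiv v1 p. 4: «ξ₁ ⊕ ξ₂ is a union of loops»)] -/
def hexCycle (x : Site 2) : Finset (Sym2 (Site 2)) := (Finset.univ : Finset (Fin 6)).image fun j => s(x, x + triDir j)

/-- a lattice bond lies on the hexagon cycle around `x` iff `x` is one of its endpoints. [cite: KhristoforovSmirnov2021, §1.2 (arXiv v1 p. 4)] -/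
theorem mem_hexCycle_iff {x a b : Site 2} (hab : triGraph.Adj a b) : s(a, b) ∈ hexCycle x ↔ x = a ∨ x = b := by
  unfold hexCycle
  rw [Finset.mem_image]
  constructor
  · rintro ⟨j, -, hj⟩
    rcases Sym2.eq_iff.1 hj with ⟨h1, -⟩ | ⟨h1, -⟩
    · exact Or.inl h1
    · exact Or.inr h1
  · rintro (rfl | rfl)
    · obtain ⟨j, hj⟩ := (triGraph_adj_iff_triDir x b).1 hab
      exact ⟨j, Finset.mem_univ _, by rw [hj]⟩
    · obtain ⟨j, hj⟩ := (triGraph_adj_iff_triDir x a).1 hab.symm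
      exact ⟨j, Finset.mem_univ _, by rw [hj, Sym2.eq_swap]⟩

/-- the `j`-th side of a face lies on the hexagon around `x` iff `x` is one of its two endpoints `faceVertex F (j+1)`, `faceVertex F (j+2)`.
[cite: BollobasRiordan2006, Ch. 7 Lemma 12 (pp. 206–207)] -/
theorem side_mem_hexCycle_iff (x : Site 2) (F : HexVertex) (j : Fin 3) :
    side F j ∈ hexCycle x ↔ x = faceVertex F (j + 1) ∨ x = faceVertex F (j + 2) := by
  have hadj : triGraph.Adj (faceVertex F (j + 1)) (faceVertex F (j + 2)) := by
    have h := adj_faceVertex_succ F (j + 1)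
    rwa [add_assoc] at h
  unfold side
  exact mem_hexCycle_iff hadj

/-- index bookkeeping: the sides of a face containing its vertex `k` are the two sides `≠ k`, and there are two of them. [folklore] -/
private theorem card_sides_at_vertex : ∀ k : Fin 3, #((Finset.univ : Finset (Fin 3)).filter fun j => k = j + 1 ∨ k = j + 2) = 2 := by decide

/-- ★ **hexagon cycles are even at every face**: a face contains `0` or `2` bonds of the hexagon around `x` (two iff `x` is a vertex of the face).
[cite: KhristoforovSmirnov2021, §1.2 (arXiv v1 p. 4: «a union of loops»)] -/
theorem even_xiDeg_hexCycle (x : Site 2) (F : HexVertex) : Even (xiDeg (hexCycle x) F) := by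
  rw [l1_xiDeg_eq]
  have hfilter : ((Finset.univ : Finset (Fin 3)).filter fun j => side F j ∈ hexCycle x) =
      (Finset.univ : Finset (Fin 3)).filter fun j => x = faceVertex F (j + 1) ∨ x = faceVertex F (j + 2) :=
    Finset.filter_congr fun j _ => side_mem_hexCycle_iff x F j
  rw [hfilter]
  by_cases hx : ∃ k : Fin 3, x = faceVertex F k
  · obtain ⟨k, rfl⟩ := hx
    have h2 : ((Finset.univ : Finset (Fin 3)).filter fun j => faceVertex F k = faceVertex F (j + 1) ∨ faceVertex F k = faceVertex F (j + 2)) =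
        (Finset.univ : Finset (Fin 3)).filter fun j => k = j + 1 ∨ k = j + 2 :=
      Finset.filter_congr fun j _ => by rw [(faceVertex_injective F).eq_iff, (faceVertex_injective F).eq_iff]
    rw [h2, card_sides_at_vertex k]
    exact ⟨1, rfl⟩
  · have h0 : ((Finset.univ : Finset (Fin 3)).filter fun j => x = faceVertex F (j + 1) ∨ x = faceVertex F (j + 2)) = ∅ := by
      rw [Finset.filter_eq_empty_iff]
      rintro j - (h | h)
      · exact hx ⟨_, h⟩
      · exact hx ⟨_, h⟩
    rw [h0, Finset.card_empty]
    exact ⟨0, rfl⟩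

variable (D) in
/-- the hexagon around a site of `G` lies in `H_G`. [cite: KhristoforovSmirnov2021, §1.2 (arXiv v1 pp. 2–3)] -/
theorem hexCycle_subset_hBonds {x : Site 2} (hx : x ∈ D.verts) : hexCycle x ⊆ hBonds D := by
  intro b hb
  unfold hexCycle at hb
  obtain ⟨j, -, rfl⟩ := Finset.mem_image.1 hb
  exact mem_hBonds D (triGraph_adj_add_triDir x j) (Or.inl hx)

/-- toggling an edge set that is EVEN at every face preserves every parity profile. [cite: KhristoforovSmirnov2021, §1.2 (arXiv v1 p. 4: «ξ₁ ⊕ ξ₂ is a union of loops»)] -/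
theorem odd_xiDeg_symmDiff_of_even {ξ C : Finset (Sym2 (Site 2))} (hC : ∀ F, Even (xiDeg C F)) (F : HexVertex) :
    Odd (xiDeg (symmDiff ξ C) F) ↔ Odd (xiDeg ξ F) := by
  rw [xorDeg_holds ξ C F]
  have hCF : ¬ Odd (xiDeg C F) := Nat.not_odd_iff_even.2 (hC F)
  tauto

/-- the symmetric difference of two face-even sets is face-even. [cite: KhristoforovSmirnov2021, §1.2 (arXiv v1 p. 4)] -/
theorem even_xiDeg_symmDiff {A B : Finset (Sym2 (Site 2))} (hA : ∀ F, Even (xiDeg A F)) (hB : ∀ F, Even (xiDeg B F)) (F : HexVertex) :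
    Even (xiDeg (symmDiff A B) F) := by
  rw [← Nat.not_odd_iff_even, odd_xiDeg_symmDiff_of_even hB F, Nat.not_odd_iff_even]
  exact hA F

end Hexagon

/-! ### The toggle at a vertex of the face -/
section Toggle

variable {v : HexVertex} (hv : AllSides D v)
include hv

/-- if the vertex `x_m` of `v` is off `G`, the other two vertices are in `G` (the sides at `x_m` are `H_G`-bonds). [cite: KhristoforovSmirnov2021, §2 Lemma 4 (arXiv v1 p. 4)] -/
theorem faceVertex_mem_of_not_mem {m : Fin 3} (hm : faceVertex v m ∉ D.verts) :
    faceVertex v (m + 1) ∈ D.verts ∧ faceVertex v (m + 2) ∈ D.verts := by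
  have key : ∀ i : Fin 3, faceVertex v (i + 1) ∈ D.verts ∨ faceVertex v (i + 2) ∈ D.verts := by
    intro i
    obtain ⟨a, b, he, ha, -⟩ := exists_rep_of_mem_hBonds D (hv i)
    unfold side at he
    rcases Sym2.eq_iff.1 he with ⟨h1, -⟩ | ⟨-, h2⟩
    · exact Or.inl (h1 ▸ ha)
    · exact Or.inr (h2 ▸ ha)
  have e : ∀ m : Fin 3, m + 1 + 2 = m ∧ m + 2 + 1 = m ∧ m + 1 + 1 = m + 2 ∧ m + 2 + 2 = m + 1 := by decide
  obtain ⟨e1, e2, e3, e4⟩ := e m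
  constructor
  · have h := key (m + 2)
    rw [e2, e4] at h
    exact h.resolve_left hm
  · have h := key (m + 1)
    rw [e3, e1] at h
    exact h.resolve_right hm

variable (D v) in
open Classical in
/-- **the toggle cycle at the vertex `x_m` of `v`**: the hexagon around `x_m` if `x_m ∈ G`, else the two hexagons around the other two vertices.
[cite: KhristoforovSmirnov2021, §1.2 (arXiv v1 p. 4: «a union of loops»)] -/
noncomputable def toggleAt (m : Fin 3) : Finset (Sym2 (Site 2)) :=
  if faceVertex v m ∈ D.verts then hexCycle (faceVertex v m)
  else symmDiff (hexCycle (faceVertex v (m + 1))) (hexCycle (faceVertex v (m + 2)))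

omit hv in
/-- the toggle cycle is even at every face. [cite: KhristoforovSmirnov2021, §1.2 (arXiv v1 p. 4)] -/
theorem even_xiDeg_toggleAt (m : Fin 3) (F : HexVertex) : Even (xiDeg (toggleAt D v m) F) := by
  unfold toggleAt
  split_ifs
  · exact even_xiDeg_hexCycle _ F
  · exact even_xiDeg_symmDiff (even_xiDeg_hexCycle _) (even_xiDeg_hexCycle _) F

/-- the toggle cycle lies in `H_G`. [cite: KhristoforovSmirnov2021, §1.2 (arXiv v1 pp. 2–3)] -/
theorem toggleAt_subset_hBonds (m : Fin 3) : toggleAt D v m ⊆ hBonds D := by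
  unfold toggleAt
  split_ifs with h
  · exact hexCycle_subset_hBonds D h
  · obtain ⟨h1, h2⟩ := faceVertex_mem_of_not_mem hv h
    intro b hb
    rcases Finset.mem_symmDiff.1 hb with ⟨hb1, -⟩ | ⟨hb2, -⟩
    · exact hexCycle_subset_hBonds D h1 hb1
    · exact hexCycle_subset_hBonds D h2 hb2

omit hv in
/-- ★ **the toggle cycle at `x_m` meets the sides of `v` exactly in the two sides at `x_m`** (the sides `≠ m`). [cite: BollobasRiordan2006, Ch. 7 Lemma 12 (pp. 206–207)] -/
theorem side_mem_toggleAt_iff (m j : Fin 3) : side v j ∈ toggleAt D v m ↔ j ≠ m := by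
  have idx : ∀ m j : Fin 3, ((m = j + 1 ∨ m = j + 2) ↔ j ≠ m) ∧
      (((m + 1 = j + 1 ∨ m + 1 = j + 2) ∧ ¬ (m + 2 = j + 1 ∨ m + 2 = j + 2) ∨
        (m + 2 = j + 1 ∨ m + 2 = j + 2) ∧ ¬ (m + 1 = j + 1 ∨ m + 1 = j + 2)) ↔ j ≠ m) := by decide
  have hinj : ∀ {a b : Fin 3}, faceVertex v a = faceVertex v b ↔ a = b := fun {a b} => (faceVertex_injective v).eq_iff
  unfold toggleAt
  split_ifs
  · rw [side_mem_hexCycle_iff, hinj, hinj]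
    exact (idx m j).1
  · rw [Finset.mem_symmDiff, side_mem_hexCycle_iff, side_mem_hexCycle_iff, hinj, hinj, hinj, hinj]
    exact (idx m j).2

end Toggle

/-! ### The count -/
section Count

/-- the subsets of `Fin 3` of even size: empty, or the complement of one point. [folklore] -/
private theorem even_subsets_fin3 : ∀ s : Finset (Fin 3), Even s.card → s = ∅ ∨ ∃ m : Fin 3, ∀ j, j ∈ s ↔ j ≠ m := by decide

variable {v : HexVertex} (hv : AllSides D v)
include hv

/-- the parity target at `v`: corners XOR the three neighbours. [cite: KhristoforovSmirnov2021, §2 Lemma 4, proof and Fig. 3 (arXiv v1 p. 4)] -/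
private theorem target_subset : symmDiff (corners D) ((Finset.univ : Finset (Fin 3)).image (oppFace v)) ⊆ triFacesTouching D.verts := by
  intro F hF
  rcases Finset.mem_symmDiff.1 hF with ⟨hc, -⟩ | ⟨ho, -⟩
  · obtain ⟨i, rfl⟩ := (mem_corners D).1 hc
    exact yc_mem_touching D i
  · obtain ⟨i, -, rfl⟩ := Finset.mem_image.1 ho
    have h := hv i
    rw [← side_oppFace_oppIdx v i] at h
    exact mem_touching_of_side_mem D h

omit hv in
/-- the target has even size when the number of marks is odd (`k` corners, three neighbours). [cite: KhristoforovSmirnov2021, §1.2 (arXiv v1 p. 3)] -/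
private theorem target_even (hodd : Odd nm) : Even #(symmDiff (corners D) ((Finset.univ : Finset (Fin 3)).image (oppFace v))) := by
  classical
  have hc : #(corners D) = nm := by
    unfold corners
    rw [Finset.card_image_of_injective _ (yc_injective D), Finset.card_univ, Fintype.card_fin]
  have ho : #((Finset.univ : Finset (Fin 3)).image (oppFace v)) = 3 := by
    rw [Finset.card_image_of_injective _ (oppFace_injective' v), Finset.card_univ, Fintype.card_fin]
  set A := corners D
  set B := (Finset.univ : Finset (Fin 3)).image (oppFace v)
  have h1 : #(A \ B) + #(A ∩ B) = #A := Finset.card_sdiff_add_card_inter A B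
  have h2 : #(B \ A) + #(B ∩ A) = #B := Finset.card_sdiff_add_card_inter B A
  have h3 : #(symmDiff A B) = #(A \ B) + #(B \ A) := by
    rw [Finset.symmDiff_def, Finset.card_union_of_disjoint disjoint_sdiff_sdiff]
  rw [Finset.inter_comm] at h2
  rw [hc] at h1; rw [ho] at h2
  obtain ⟨r, hr⟩ := hodd
  refine ⟨r + 2 - #(A ∩ B), ?_⟩
  have hle : #(A ∩ B) ≤ 3 := by rw [← ho]; exact Finset.card_le_card Finset.inter_subset_right
  omega

/-- the face `v` is not in the target (it is neither a corner — corners have a side off `H_G` — nor its own neighbour) but touches `G`.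
[cite: KhristoforovSmirnov2021, §2 Lemma 4 (arXiv v1 p. 4)] -/
private theorem v_not_mem_target : v ∉ symmDiff (corners D) ((Finset.univ : Finset (Fin 3)).image (oppFace v)) ∧ v ∈ triFacesTouching D.verts := by
  refine ⟨fun h => ?_, mem_touching_of_side_mem D (hv 0)⟩
  rcases Finset.mem_symmDiff.1 h with ⟨hc, -⟩ | ⟨ho, -⟩
  · obtain ⟨i, hi⟩ := (mem_corners D).1 hc
    exact hbK_yc_ne_v hv i hi.symm
  · obtain ⟨i, -, hi⟩ := Finset.mem_image.1 ho
    exact (hexGraph_adj_oppFace v i).ne hi.symm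

/-- ★★ **THE CENSUS SIZE LAW**: at a face `v` with three `H_G`-sides of a `k`-marked domain, `k` odd, the cores with all three neighbours odd number exactly
`2 ^ (#G − 2)`. [cite: KhristoforovSmirnov2021, §1.2 (arXiv v1 p. 3: «exactly `2^{#Faces(Ω)}` loop configurations»); §2 Lemma 4, proof and Fig. 3 (p. 4)] -/
theorem card_cores_eq (hodd : Odd nm) [DecidablePred fun ζ => IsCoreb D v Finset.univ ζ] :
    #((hBonds D).powerset.filter fun ζ => IsCoreb D v Finset.univ ζ) = 2 ^ (#D.verts - 2) := by
  classical
  set U := symmDiff (corners D) ((Finset.univ : Finset (Fin 3)).image (oppFace v)) with hU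
  set P := (hBonds D).powerset.filter fun ξ => ∀ F ∈ triFacesTouching D.verts, (Odd (xiDeg ξ F) ↔ F ∈ U) with hP
  have hPcard : #P = 2 ^ #D.verts := card_filter_parity_eq D (target_subset hv) (target_even hodd)
  have memP : ∀ ξ, ξ ∈ P ↔ ξ ⊆ hBonds D ∧ ∀ F ∈ triFacesTouching D.verts, (Odd (xiDeg ξ F) ↔ F ∈ U) := fun ξ => by
    rw [hP, Finset.mem_filter, Finset.mem_powerset]
  -- the parity at `v`: an even number of sides of `v`
  have sides_even : ∀ ξ ∈ P, ((∀ j, side v j ∉ ξ) ∨ ∃ m : Fin 3, ∀ j, side v j ∈ ξ ↔ j ≠ m) := by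
    intro ξ hξ
    obtain ⟨-, hpar⟩ := (memP ξ).1 hξ
    obtain ⟨hvU, hvt⟩ := v_not_mem_target hv
    have heven : Even (xiDeg ξ v) := by
      rw [← Nat.not_odd_iff_even]; exact fun ho => hvU ((hpar v hvt).1 ho)
    rw [l1_xiDeg_eq] at heven
    rcases even_subsets_fin3 _ heven with h0 | ⟨m, hm⟩
    · left; intro j hj
      have : j ∈ ((Finset.univ : Finset (Fin 3)).filter fun j => side v j ∈ ξ) := Finset.mem_filter.2 ⟨Finset.mem_univ _, hj⟩
      rw [h0] at this; exact absurd this (Finset.notMem_empty _)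
    · right; refine ⟨m, fun j => ?_⟩
      rw [← hm j, Finset.mem_filter]
      exact ⟨fun h => ⟨Finset.mem_univ _, h⟩, fun h => h.2⟩
  -- the four classes
  set P₀ := P.filter fun ξ => ∀ j, side v j ∉ ξ with hP₀
  set Pm : Fin 3 → Finset (Finset (Sym2 (Site 2))) := fun m => P.filter fun ξ => ∀ j, side v j ∈ ξ ↔ j ≠ m with hPm
  -- the cores are `P₀`
  have hcores : ((hBonds D).powerset.filter fun ζ => IsCoreb D v Finset.univ ζ) = P₀ := by
    ext ζ
    rw [Finset.mem_filter, Finset.mem_powerset, hP₀, Finset.mem_filter, memP]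
    constructor
    · rintro ⟨hζh, hζE, -, hpar⟩
      refine ⟨⟨hζh, hpar⟩, fun j hj => ?_⟩
      have h := hζE hj
      unfold Eminus at h
      exact (Finset.mem_filter.1 h).2 j rfl
    · rintro ⟨⟨hζh, hpar⟩, hsides⟩
      refine ⟨hζh, fun b hb => ?_, by decide, hpar⟩
      unfold Eminus
      exact Finset.mem_filter.2 ⟨hζh hb, fun j hj => hsides j (hj ▸ hb)⟩
  -- the three other classes are in bijection with the cores by the toggle at a vertex
  have hcardPm : ∀ m : Fin 3, #(Pm m) = #P₀ := by
    intro m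
    have hC := toggleAt_subset_hBonds hv m
    have hCe := even_xiDeg_toggleAt (D := D) (v := v) m
    have hCs := side_mem_toggleAt_iff (D := D) (v := v) m
    -- the toggle maps each class into the other
    have into : ∀ ξ, ξ ∈ P → symmDiff ξ (toggleAt D v m) ∈ P := by
      intro ξ hξ
      obtain ⟨hξh, hpar⟩ := (memP ξ).1 hξ
      refine (memP _).2 ⟨fun b hb => ?_, fun F hF => ?_⟩
      · rcases Finset.mem_symmDiff.1 hb with ⟨h1, -⟩ | ⟨h2, -⟩
        · exact hξh h1
        · exact hC h2
      · rw [odd_xiDeg_symmDiff_of_even hCe F]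
        exact hpar F hF
    symm
    refine Finset.card_bij' (fun ξ _ => symmDiff ξ (toggleAt D v m)) (fun ξ _ => symmDiff ξ (toggleAt D v m)) (fun ξ hξ => ?_) (fun ξ hξ => ?_)
      (fun ξ _ => symmDiff_symmDiff_cancel_right _ _) (fun ξ _ => symmDiff_symmDiff_cancel_right _ _)
    · simp only [hP₀, Finset.mem_filter] at hξ
      simp only [hPm, Finset.mem_filter]
      refine ⟨into ξ hξ.1, fun j => ?_⟩
      rw [Finset.mem_symmDiff, hCs j]
      have := hξ.2 j
      tauto
    · simp only [hPm, Finset.mem_filter] at hξ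
      simp only [hP₀, Finset.mem_filter]
      refine ⟨into ξ hξ.1, fun j h => ?_⟩
      rw [Finset.mem_symmDiff, hCs j, hξ.2 j] at h
      tauto
  -- the split of `P` into the four classes
  have h3 : ∀ m : Fin 3, m = 0 ∨ m = 1 ∨ m = 2 := by decide
  have hrest : P.filter (fun ξ => ¬ ∀ j, side v j ∉ ξ) = Pm 0 ∪ Pm 1 ∪ Pm 2 := by
    ext ξ
    rw [Finset.mem_filter, Finset.mem_union, Finset.mem_union]
    constructor
    · rintro ⟨hξ, hnot⟩
      rcases sides_even ξ hξ with h0 | ⟨m, hm⟩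
      · exact absurd h0 hnot
      · have hmem : ξ ∈ Pm m := by simp only [hPm, Finset.mem_filter]; exact ⟨hξ, hm⟩
        rcases h3 m with rfl | rfl | rfl
        · exact Or.inl (Or.inl hmem)
        · exact Or.inl (Or.inr hmem)
        · exact Or.inr hmem
    · intro h
      have key : ∀ m, ξ ∈ Pm m → ξ ∈ P ∧ ¬ ∀ j, side v j ∉ ξ := by
        intro m hm
        simp only [hPm, Finset.mem_filter] at hm
        refine ⟨hm.1, fun hall => hall (m + 1) ((hm.2 (m + 1)).2 ?_)⟩
        have : ∀ m : Fin 3, m + 1 ≠ m := by decide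
        exact this m
      rcases h with (h | h) | h
      · exact key 0 h
      · exact key 1 h
      · exact key 2 h
  have hdisj : ∀ m m' : Fin 3, m ≠ m' → Disjoint (Pm m) (Pm m') := by
    intro m m' hmm'
    rw [Finset.disjoint_left]
    intro ξ h1 h2
    simp only [hPm, Finset.mem_filter] at h1 h2
    have a : side v m ∉ ξ := fun h => ((h1.2 m).1 h) rfl
    exact a ((h2.2 m).2 hmm')
  have hsum : #P = #P₀ + (#(Pm 0) + #(Pm 1) + #(Pm 2)) := by
    rw [← Finset.card_filter_add_card_filter_not (fun ξ => ∀ j, side v j ∉ ξ) (s := P), ← hP₀, hrest,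
      Finset.card_union_of_disjoint, Finset.card_union_of_disjoint (hdisj 0 1 (by decide))]
    rw [Finset.disjoint_union_left]
    exact ⟨hdisj 0 2 (by decide), hdisj 1 2 (by decide)⟩
  rw [hcardPm 0, hcardPm 1, hcardPm 2, hPcard] at hsum
  -- `#G ≥ 2`: two vertices of `v` lie in `G`
  have hG2 : 2 ≤ #D.verts := by
    have hinj := faceVertex_injective v
    have ne : ∀ a b : Fin 3, a ≠ b → faceVertex v a ≠ faceVertex v b := fun a b h e => h (hinj e)
    by_cases h0 : faceVertex v 0 ∈ D.verts
    · obtain ⟨a, b, he, ha, -⟩ := exists_rep_of_mem_hBonds D (hv 0)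
      have hab : faceVertex v (0 + 1) ∈ D.verts ∨ faceVertex v (0 + 2) ∈ D.verts := by
        unfold side at he
        rcases Sym2.eq_iff.1 he with ⟨h1, -⟩ | ⟨-, h2⟩
        · exact Or.inl (h1 ▸ ha)
        · exact Or.inr (h2 ▸ ha)
      rcases hab with h | h
      · calc 2 = #({faceVertex v 0, faceVertex v (0 + 1)} : Finset (Site 2)) := (Finset.card_pair (ne 0 (0 + 1) (by decide))).symm
          _ ≤ #D.verts := Finset.card_le_card (Finset.insert_subset h0 (Finset.singleton_subset_iff.2 h))
      · calc 2 = #({faceVertex v 0, faceVertex v (0 + 2)} : Finset (Site 2)) := (Finset.card_pair (ne 0 (0 + 2) (by decide))).symm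
          _ ≤ #D.verts := Finset.card_le_card (Finset.insert_subset h0 (Finset.singleton_subset_iff.2 h))
    · obtain ⟨h1, h2⟩ := faceVertex_mem_of_not_mem hv h0
      calc 2 = #({faceVertex v (0 + 1), faceVertex v (0 + 2)} : Finset (Site 2)) := (Finset.card_pair (ne (0 + 1) (0 + 2) (by decide))).symm
        _ ≤ #D.verts := Finset.card_le_card (Finset.insert_subset h1 (Finset.singleton_subset_iff.2 h2))
  rw [hcores]
  have e : #D.verts = (#D.verts - 2) + 2 := by omega
  rw [e, pow_add] at hsum
  have : 4 * #P₀ = 4 * 2 ^ (#D.verts - 2) := by linarith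
  omega

/-- ★★ the same count on the tree's finset of cores `coreSetb D v` (pairs `(S, ζ)`): the cores with `S = univ` number `2 ^ (#G − 2)`.
[cite: KhristoforovSmirnov2021, §1.2 (arXiv v1 p. 3); §2 Lemma 4, proof and Fig. 3 (p. 4)] -/
theorem card_coreSetb_univ (hodd : Odd nm) :
    #((coreSetb D v).filter fun q => q.1 = Finset.univ) = 2 ^ (#D.verts - 2) := by
  classical
  rw [← card_cores_eq hv hodd]
  refine Finset.card_bij (fun q _ => q.2) (fun q hq => ?_) (fun q hq q' hq' h => ?_) (fun ζ hζ => ?_)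
  · rw [Finset.mem_filter] at hq ⊢
    obtain ⟨hmem, hS⟩ := hq
    unfold coreSetb at hmem
    obtain ⟨-, hcore⟩ := Finset.mem_filter.1 hmem
    rw [hS] at hcore
    refine ⟨Finset.mem_powerset.2 fun b hb => ?_, hcore⟩
    have h := hcore.1 hb
    unfold Eminus at h
    exact (Finset.mem_filter.1 h).1
  · rw [Finset.mem_filter] at hq hq'
    exact Prod.ext (hq.2.trans hq'.2.symm) h
  · rw [Finset.mem_filter] at hζ
    refine ⟨(Finset.univ, ζ), Finset.mem_filter.2 ⟨?_, rfl⟩, rfl⟩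
    unfold coreSetb
    exact Finset.mem_filter.2 ⟨Finset.mem_product.2 ⟨Finset.mem_univ _, Finset.mem_powerset.2 hζ.2.1⟩, hζ.2⟩

/-- ★ **COMPLETENESS OF A CENSUS TABLE FROM ITS SIZE**: an injective table of `2 ^ (#G − 2)` cores at `v` (all three neighbours odd) contains EVERY such core —
so a kernel census (`MarkedLoopCoreCensus.lean`) may certify completeness by counting instead of peeling. [cite: KhristoforovSmirnov2021, §1.2 (arXiv v1 p. 3:
«exactly `2^{#Faces(Ω)}` loop configurations»); §2 Lemma 4, proof and Fig. 3 (p. 4)] -/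
theorem exists_eq_of_card_table (hodd : Odd nm) {ι : Type*} [Fintype ι] (core : ι → Finset (Sym2 (Site 2))) (hinj : Function.Injective core)
    (hcore : ∀ i, IsCoreb D v Finset.univ (core i)) (hcard : Fintype.card ι = 2 ^ (#D.verts - 2))
    {ζ : Finset (Sym2 (Site 2))} (hζ : IsCoreb D v Finset.univ ζ) : ∃ i, ζ = core i := by
  classical
  set C := (hBonds D).powerset.filter fun ζ => IsCoreb D v Finset.univ ζ with hC
  have memC : ∀ ξ, ξ ∈ C ↔ IsCoreb D v Finset.univ ξ := fun ξ => by
    rw [hC, Finset.mem_filter, Finset.mem_powerset]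
    constructor
    · exact fun h => h.2
    · intro h
      refine ⟨fun b hb => ?_, h⟩
      have hb' := h.1 hb
      unfold Eminus at hb'
      exact (Finset.mem_filter.1 hb').1
  have hsub : (Finset.univ : Finset ι).image core ⊆ C := by
    intro ξ hξ
    obtain ⟨i, -, rfl⟩ := Finset.mem_image.1 hξ
    exact (memC _).2 (hcore i)
  have hle : #C ≤ #((Finset.univ : Finset ι).image core) := by
    rw [Finset.card_image_of_injective _ hinj, Finset.card_univ, hcard, hC, card_cores_eq hv hodd]
  have heq := Finset.eq_of_subset_of_card_le hsub hle
  have hmem : ζ ∈ (Finset.univ : Finset ι).image core := by rw [heq]; exact (memC ζ).2 hζ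
  obtain ⟨i, -, hi⟩ := Finset.mem_image.1 hmem
  exact ⟨i, hi.symm⟩

end Count

end Literature.Probability.Percolation.MarkedLoops
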